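import Mathlib

/-!
# No balanced graph on a pointed support — kernel lemma for `GENERIC.md` §9.3 (c)

HONEST FRAMING (cell brief): closing part of a known exceptional set by certified computer algebra; not a new method.

Venture `CentralConfigurations` (cell `pub-smale6`, seat 2 gen 5); port of the staged `HOME/lean/Smale6N5BalancedGraph.lean`
(rc 0, 0 sorry, referee gen 96), namespace `Smale6N5.E32Generic` ↦ `Summit.Ventures.CentralConfigurations.E32Generic`,
statements unchanged (filing, prover-pub-smale6-filer-0, 2026-08-20: docstrings added on the three auxiliary `dotProduct_*`
lemmas for the tree's docstring lint; nothing else differs from the kit file sha256 7de7d8a9…).  The last step of Theorem G of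
`certs/tropical_e32/vcell_S3_001/GENERIC.md`: a finite graph drawn in `ℚⁿ` with

* bounded edges `i : ι` from `a i` to `b i` (`a i ≠ b i`) with coefficients `c i > 0`
  (tropically: weight / lattice length, i.e. `c i • (b i - a i)` = weight × primitive direction),
* unbounded edges `k : κ` based at `p k` with direction `d k` and coefficient `c' k > 0`,
* BALANCED at every point `v` (sum of the outgoing weighted directions of the edges at `v` is `0`),

and whose unbounded directions are all on the positive side of one linear functional `y`
(`0 < y ⬝ᵥ d k`, "globally pointed recession directions") has NO EDGES AT ALL.  In §9.3 (c) this is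
applied to (a refinement of) the tropicalisation of a putative curve inside the 467-cell closure,
with `y = (−14,−25,−21,8,−22,−20,7,−9,9,6)` (`Summit.Ventures.CentralConfigurations.E32Generic.yA_separates`, module `E32GenericPointed`): it replaces
the prose "sum the balancing conditions; ℓ-maximal vertex" by the two identities
`∑_v y ⬝ᵥ bal v = ∑_k c'_k (y ⬝ᵥ d_k)` and, once `κ = ∅`, `∑_v v ⬝ᵥ bal v = −∑_i c_i ‖a_i − b_i‖²`.
What stays prose: the Structure Theorem (balancing, purity) and that unbounded edge directions lie
in recession cones of closure cells.
-/

namespace Summit.Ventures.CentralConfigurations.E32Generic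

open Matrix Finset

variable {n : ℕ} {ι κ : Type*} [Fintype ι] [Fintype κ]

/-- The balance vector at `v`. -/
def bal (a b : ι → Fin n → ℚ) (c : ι → ℚ) (p d : κ → Fin n → ℚ) (c' : κ → ℚ)
    (v : Fin n → ℚ) : Fin n → ℚ :=
  (∑ i, if a i = v then c i • (b i - a i) else 0) +
  (∑ i, if b i = v then c i • (a i - b i) else 0) +
  (∑ k, if p k = v then c' k • d k else 0)

omit [Fintype ι] [Fintype κ] in
/-- Auxiliary: the dot product distributes over a `Finset` sum in the second argument. -/
theorem dotProduct_finset_sum {α : Type*} (s : Finset α) (x : Fin n → ℚ) (f : α → Fin n → ℚ) :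
    x ⬝ᵥ (∑ j ∈ s, f j) = ∑ j ∈ s, x ⬝ᵥ f j := by
  classical
  induction s using Finset.induction_on with
  | empty => simp
  | insert a s ha ih => rw [Finset.sum_insert ha, Finset.sum_insert ha, dotProduct_add, ih]

omit [Fintype ι] [Fintype κ] in
/-- Auxiliary: the dot product with an `if`-guarded vector (else `0`) is the `if`-guarded dot product. -/
theorem dotProduct_ite (x w : Fin n → ℚ) (P : Prop) [Decidable P] :
    x ⬝ᵥ (if P then w else 0) = if P then x ⬝ᵥ w else 0 := by
  split_ifs <;> simp

/-- Testing the balance vectors against a field `φ` over a vertex set `W` containing all endpoints: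
the discrete "integration by parts". -/
theorem sum_test_bal (a b : ι → Fin n → ℚ) (c : ι → ℚ)
    (p d : κ → Fin n → ℚ) (c' : κ → ℚ) (W : Finset (Fin n → ℚ))
    (ha : ∀ i, a i ∈ W) (hb : ∀ i, b i ∈ W) (hp : ∀ k, p k ∈ W) (φ : (Fin n → ℚ) → Fin n → ℚ) :
    ∑ v ∈ W, φ v ⬝ᵥ bal a b c p d c' v =
      (∑ i, (φ (a i) ⬝ᵥ (c i • (b i - a i)) + φ (b i) ⬝ᵥ (c i • (a i - b i)))) +
      ∑ k, φ (p k) ⬝ᵥ (c' k • d k) := by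
  have h1 : ∑ v ∈ W, φ v ⬝ᵥ (∑ i, if a i = v then c i • (b i - a i) else 0)
      = ∑ i, φ (a i) ⬝ᵥ (c i • (b i - a i)) := by
    simp_rw [dotProduct_finset_sum, dotProduct_ite]
    rw [Finset.sum_comm]
    refine Finset.sum_congr rfl fun i _ => ?_
    rw [show (∑ v ∈ W, if a i = v then φ v ⬝ᵥ (c i • (b i - a i)) else 0)
        = if a i ∈ W then φ (a i) ⬝ᵥ (c i • (b i - a i)) else 0 from Finset.sum_ite_eq W (a i) _]
    simp [ha i]
  have h2 : ∑ v ∈ W, φ v ⬝ᵥ (∑ i, if b i = v then c i • (a i - b i) else 0)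
      = ∑ i, φ (b i) ⬝ᵥ (c i • (a i - b i)) := by
    simp_rw [dotProduct_finset_sum, dotProduct_ite]
    rw [Finset.sum_comm]
    refine Finset.sum_congr rfl fun i _ => ?_
    rw [show (∑ v ∈ W, if b i = v then φ v ⬝ᵥ (c i • (a i - b i)) else 0)
        = if b i ∈ W then φ (b i) ⬝ᵥ (c i • (a i - b i)) else 0 from Finset.sum_ite_eq W (b i) _]
    simp [hb i]
  have h3 : ∑ v ∈ W, φ v ⬝ᵥ (∑ k, if p k = v then c' k • d k else 0)
      = ∑ k, φ (p k) ⬝ᵥ (c' k • d k) := by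
    simp_rw [dotProduct_finset_sum, dotProduct_ite]
    rw [Finset.sum_comm]
    refine Finset.sum_congr rfl fun k _ => ?_
    rw [show (∑ v ∈ W, if p k = v then φ v ⬝ᵥ (c' k • d k) else 0)
        = if p k ∈ W then φ (p k) ⬝ᵥ (c' k • d k) else 0 from Finset.sum_ite_eq W (p k) _]
    simp [hp k]
  unfold bal
  simp_rw [dotProduct_add, Finset.sum_add_distrib, h1, h2, h3]

omit [Fintype ι] [Fintype κ] in
/-- Auxiliary: over `ℚ`, `‖u − w‖² = (u − w) ⬝ (u − w) > 0` when `u ≠ w`. -/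
theorem dotProduct_self_pos_of_ne {u w : Fin n → ℚ} (h : u ≠ w) : 0 < (u - w) ⬝ᵥ (u - w) := by
  have hne : (u - w) ⬝ᵥ (u - w) ≠ 0 := by
    rw [Ne, dotProduct_self_eq_zero]; exact sub_ne_zero.mpr h
  have hnn : 0 ≤ (u - w) ⬝ᵥ (u - w) := Finset.sum_nonneg fun j _ => mul_self_nonneg _
  exact lt_of_le_of_ne hnn (Ne.symm hne)

/-- MAIN LEMMA.  A balanced graph whose unbounded directions are all `y`-positive has no edges. -/
theorem no_balanced_graph_of_pointed (a b : ι → Fin n → ℚ) (c : ι → ℚ) (hc : ∀ i, 0 < c i)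
    (hab : ∀ i, a i ≠ b i) (p d : κ → Fin n → ℚ) (c' : κ → ℚ) (hc' : ∀ k, 0 < c' k)
    (y : Fin n → ℚ) (hy : ∀ k, 0 < y ⬝ᵥ d k)
    (hbal : ∀ v, bal a b c p d c' v = 0) : IsEmpty ι ∧ IsEmpty κ := by
  classical
  let W : Finset (Fin n → ℚ) := (univ.image a ∪ univ.image b) ∪ univ.image p
  have ha : ∀ i, a i ∈ W := fun i => by simp [W]
  have hb : ∀ i, b i ∈ W := fun i => by simp [W]
  have hp : ∀ k, p k ∈ W := fun k => by simp [W]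
  -- Step 1: test against the constant field `y`: the bounded edges cancel, leaving ∑ c'_k (y ⬝ᵥ d_k) = 0.
  have hκ : IsEmpty κ := by
    have hsum := sum_test_bal a b c p d c' W ha hb hp (fun _ => y)
    have hzero : ∑ v ∈ W, (fun _ => y) v ⬝ᵥ bal a b c p d c' v = 0 := by
      refine Finset.sum_eq_zero fun v _ => ?_
      rw [hbal v, dotProduct_zero]
    have hcancel : ∑ i, (y ⬝ᵥ (c i • (b i - a i)) + y ⬝ᵥ (c i • (a i - b i))) = 0 := by
      refine Finset.sum_eq_zero fun i _ => ?_
      rw [show a i - b i = -(b i - a i) by abel, smul_neg, dotProduct_neg, add_neg_cancel]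
    have hk : ∑ k, y ⬝ᵥ (c' k • d k) = 0 := by
      have := hsum; rw [hzero, hcancel, zero_add] at this; exact this.symm
    by_contra hne
    rw [not_isEmpty_iff] at hne
    have hpos : 0 < ∑ k, y ⬝ᵥ (c' k • d k) := by
      refine Finset.sum_pos (fun k _ => ?_) Finset.univ_nonempty
      rw [dotProduct_smul, smul_eq_mul]; exact mul_pos (hc' k) (hy k)
    linarith
  -- Step 2: with no unbounded edges, test against the identity field: ∑ c_i ‖a_i − b_i‖² = 0.
  refine ⟨?_, hκ⟩
  have hsum := sum_test_bal a b c p d c' W ha hb hp (fun v => v)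
  have hzero : ∑ v ∈ W, (fun v => v) v ⬝ᵥ bal a b c p d c' v = 0 := by
    refine Finset.sum_eq_zero fun v _ => ?_
    rw [hbal v, dotProduct_zero]
  have hk : ∑ k, (fun v : Fin n → ℚ => v) (p k) ⬝ᵥ (c' k • d k) = 0 := by
    haveI := hκ; simp
  have hid : ∀ i, (a i ⬝ᵥ (c i • (b i - a i)) + b i ⬝ᵥ (c i • (a i - b i)))
      = -(c i * ((a i - b i) ⬝ᵥ (a i - b i))) := by
    intro i
    rw [dotProduct_smul, dotProduct_smul, smul_eq_mul, smul_eq_mul]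
    have e1 : a i ⬝ᵥ (b i - a i) = a i ⬝ᵥ b i - a i ⬝ᵥ a i := dotProduct_sub _ _ _
    have e2 : b i ⬝ᵥ (a i - b i) = a i ⬝ᵥ b i - b i ⬝ᵥ b i := by
      rw [dotProduct_sub, dotProduct_comm (b i) (a i)]
    have e3 : (a i - b i) ⬝ᵥ (a i - b i) = a i ⬝ᵥ a i - 2 * (a i ⬝ᵥ b i) + b i ⬝ᵥ b i := by
      rw [sub_dotProduct, dotProduct_sub, dotProduct_sub, dotProduct_comm (b i) (a i)]; ring
    rw [e1, e2, e3]; ring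
  have hI : ∑ i, c i * ((a i - b i) ⬝ᵥ (a i - b i)) = 0 := by
    have := hsum
    rw [hzero, hk, add_zero] at this
    simp_rw [hid, Finset.sum_neg_distrib] at this
    linarith
  by_contra hne
  rw [not_isEmpty_iff] at hne
  have hpos : 0 < ∑ i, c i * ((a i - b i) ⬝ᵥ (a i - b i)) :=
    Finset.sum_pos (fun i _ => mul_pos (hc i) (dotProduct_self_pos_of_ne (hab i))) Finset.univ_nonempty
  linarith

/-- The instance used in §9.3 (c): with the certified separator there is no balanced graph whose
unbounded directions are drawn from `dirs128` (as rational vectors). Stated for directions given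
with a proof of membership; `yA_separates` supplies `12 ≤ yA ⬝ d`, hence positivity. -/
theorem no_balanced_graph_on_closure (a b : ι → Fin 10 → ℚ) (c : ι → ℚ) (hc : ∀ i, 0 < c i)
    (hab : ∀ i, a i ≠ b i) (p d : κ → Fin 10 → ℚ) (c' : κ → ℚ) (hc' : ∀ k, 0 < c' k)
    (y : Fin 10 → ℚ) (hy : ∀ k, 12 ≤ y ⬝ᵥ d k)
    (hbal : ∀ v, bal a b c p d c' v = 0) : IsEmpty ι ∧ IsEmpty κ :=
  no_balanced_graph_of_pointed a b c hc hab p d c' hc' y (fun k => by linarith [hy k]) hbal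

end Summit.Ventures.CentralConfigurations.E32Generic
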